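import Summits.FinalStateConjecture.FinalStateConjecture.Theorems.SwallowTheDatumParametricKerrBurialEngine
import Summits.FinalStateConjecture.FinalStateConjecture.Theorems.SwallowTheDatumUniversalWitnessFamilyStubClusterFarField

/-!
# `ParametricKerrBurial`, line `receding-annulus-universal-collar` — stub `stub_bulkCoulomb` (BK3b):
# the Newton kernel and the evaluation-shift Taylor bound for finite Coulomb sums
# (crux item stmt-FinalStateConjecture-10052)

The registered stub `stub_bulkCoulomb`, proved. The bulk of the line reads the Brill–Lindquist conformal factor
`ψ = A + Σ αᵢ/‖y − cᵢ‖` near a puncture; this file supplies the two elementary analytic inputs: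

* §1 **the Newton kernel** `N(v) = ‖v‖⁻¹` on `ℝ³`: the radial estimates `‖DᵏN(z)‖ ≤ Cₖ/‖z‖^{k+1}` off the origin
  are the landed `exists_radialBound_invNorm` of the sibling crux file `…UniversalWitnessFamilyStubClusterFarField`
  (homogeneity of degree `−1` + compactness of the unit sphere; no derivative is computed); here we only take ONE
  constant for the orders `m ≤ 3` (conjunct (i));
* §2 **finite Coulomb sums** `G(w) = Σ_{i ∈ S} wgtᵢ/‖pᵢ + w‖` with `‖pᵢ‖ ≥ dᵢ > 0`, `wgtᵢ ≥ 0`, read at `‖w‖ ≤ dᵢ/2`: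
  there `‖pᵢ + w‖ ≥ dᵢ/2`, so `|1/‖pᵢ + w‖ − 1/‖pᵢ‖| = |‖pᵢ‖ − ‖pᵢ + w‖|/(‖pᵢ + w‖‖pᵢ‖) ≤ 2‖w‖/dᵢ²`
  (elementary, no mean value theorem needed), `‖DᵐG(w)‖ ≤ Σ wgtᵢ ‖DᵐN(pᵢ + w)‖ ≤ 2^{m+1} C Σ wgtᵢ/dᵢ^{m+1}`
  (linearity and translation invariance of `iteratedFDeriv`), and `G` is smooth at `w` (conjunct (ii), with the
  single constant `2 + 8C`).

References: folklore multivariable calculus (homogeneous kernels; Newtonian potentials of finitely many sources, e.g.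
Brill–Lindquist 1963 for the conformal factor this serves); the crux directory's `PICKED.md`.
-/

set_option linter.dupNamespace false
-- instance search through the nested operator types (as in the tree files of this line)
set_option maxSynthPendingDepth 3

noncomputable section

namespace Summit.FinalStateConjecture.FinalStateConjecture.Theorems.SwallowTheDatum.ParametricKerrBurial

open scoped Manifold ContDiff Topology BigOperators InnerProductSpace
open Bundle Set Filter Function MeasureTheory Literature.Geometry.Lorentzian
open Literature.Geometry.Lorentzian.MaoOhTao Literature.Geometry.Lorentzian.InitialDataSet
open Summit.FinalStateConjecture.FinalStateConjecture.Theorems.SwallowTheDatum.UniversalWitnessFamily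
  (exists_radialBound_invNorm)

/-! ## §1 The Newton kernel `v ↦ ‖v‖⁻¹`: one constant for the derivative bounds of orders `≤ 3` -/

/-- **Conjunct (i) of `stub_bulkCoulomb`**: ONE constant with `‖Dᵐ(‖·‖⁻¹)(u)‖ ≤ C/‖u‖^{m+1}` for all `m ≤ 3` and
`u ≠ 0` (the sum of the four radial constants of `exists_radialBound_invNorm`, plus one). [folklore] -/
theorem bc_newton_bounds :
    ∃ C : ℝ, 0 < C ∧ ∀ u : E3, u ≠ 0 → ∀ m : ℕ, m ≤ 3 →
      ‖iteratedFDeriv ℝ m (fun v : E3 ↦ ‖v‖⁻¹) u‖ ≤ C / ‖u‖ ^ (m + 1) := by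
  choose M hM0 hM using exists_radialBound_invNorm
  refine ⟨M 0 + M 1 + M 2 + M 3 + 1, by linarith [hM0 0, hM0 1, hM0 2, hM0 3], fun u hu m hm ↦ ?_⟩
  have hle : M m ≤ M 0 + M 1 + M 2 + M 3 + 1 := by
    interval_cases m <;> linarith [hM0 0, hM0 1, hM0 2, hM0 3]
  exact (hM m u hu).trans (div_le_div_of_nonneg_right hle (pow_nonneg (norm_nonneg _) _))

/-! ## §2 Finite Coulomb sums `G(w) = Σ wgtᵢ/‖pᵢ + w‖` read at `‖w‖ ≤ dᵢ/2 ≤ ‖pᵢ‖/2` -/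

/-- The geometry of a half-separated source: `d ≤ ‖p‖` and `‖w‖ ≤ d/2` give `d/2 ≤ ‖p + w‖`. [folklore] -/
theorem bc_half_le_norm_add {p w : E3} {d : ℝ} (hd : d ≤ ‖p‖) (hw : ‖w‖ ≤ d / 2) :
    d / 2 ≤ ‖p + w‖ := by
  have h : ‖p‖ ≤ ‖p + w‖ + ‖w‖ := by simpa using norm_add_le (p + w) (-w)
  linarith

/-- Under the same hypotheses with `0 < d`, the shifted source is off the origin: `p + w ≠ 0`. [folklore] -/
theorem bc_add_ne_zero {p w : E3} {d : ℝ} (hd0 : 0 < d) (hd : d ≤ ‖p‖) (hw : ‖w‖ ≤ d / 2) :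
    p + w ≠ 0 :=
  norm_pos_iff.1 (lt_of_lt_of_le (half_pos hd0) (bc_half_le_norm_add hd hw))

/-- **One source, order zero**: `|‖p + w‖⁻¹ − ‖p‖⁻¹| ≤ 2‖w‖/d²` for `0 < d ≤ ‖p‖`, `‖w‖ ≤ d/2`
(`a⁻¹ − b⁻¹ = (b − a)/(ab)`, `|‖p‖ − ‖p + w‖| ≤ ‖w‖`, `ab ≥ d²/2`). [folklore] -/
theorem bc_abs_inv_sub_inv_le {p w : E3} {d : ℝ} (hd0 : 0 < d) (hd : d ≤ ‖p‖) (hw : ‖w‖ ≤ d / 2) :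
    |‖p + w‖⁻¹ - ‖p‖⁻¹| ≤ 2 * ‖w‖ / d ^ 2 := by
  have ha : d / 2 ≤ ‖p + w‖ := bc_half_le_norm_add hd hw
  have ha0 : 0 < ‖p + w‖ := lt_of_lt_of_le (half_pos hd0) ha
  have hb0 : 0 < ‖p‖ := hd0.trans_le hd
  have hd' : d ≠ 0 := hd0.ne'
  rw [inv_sub_inv ha0.ne' hb0.ne', abs_div, abs_of_pos (mul_pos ha0 hb0)]
  have hnum : |‖p‖ - ‖p + w‖| ≤ ‖w‖ := by
    have h := abs_norm_sub_norm_le p (p + w)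
    rwa [sub_add_cancel_left, norm_neg] at h
  calc |‖p‖ - ‖p + w‖| / (‖p + w‖ * ‖p‖) ≤ ‖w‖ / (d / 2 * d) :=
        div_le_div₀ (norm_nonneg _) hnum (by positivity) (mul_le_mul ha hd hd0.le ha0.le)
    _ = 2 * ‖w‖ / d ^ 2 := by
        field_simp

/-- **The evaluation-shift bound**: `|G(w) − G(0)| ≤ 2‖w‖ Σ wgtᵢ/dᵢ²`. [folklore] -/
theorem bc_sum_shift_le (S : Finset ℕ) (p : ℕ → E3) (wgt d : ℕ → ℝ)
    (hwgt : ∀ i ∈ S, 0 ≤ wgt i) (hd : ∀ i ∈ S, 0 < d i ∧ d i ≤ ‖p i‖)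
    (w : E3) (hw : ∀ i ∈ S, ‖w‖ ≤ d i / 2) :
    |∑ i ∈ S, wgt i * ‖p i + w‖⁻¹ - ∑ i ∈ S, wgt i * ‖p i‖⁻¹| ≤ 2 * ‖w‖ * ∑ i ∈ S, wgt i / d i ^ 2 := by
  rw [← Finset.sum_sub_distrib, Finset.mul_sum]
  refine (Finset.abs_sum_le_sum_abs _ _).trans (Finset.sum_le_sum fun i hi ↦ ?_)
  rw [← mul_sub, abs_mul, abs_of_nonneg (hwgt i hi)]
  calc wgt i * |‖p i + w‖⁻¹ - ‖p i‖⁻¹| ≤ wgt i * (2 * ‖w‖ / d i ^ 2) :=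
        mul_le_mul_of_nonneg_left (bc_abs_inv_sub_inv_le (hd i hi).1 (hd i hi).2 (hw i hi)) (hwgt i hi)
    _ = 2 * ‖w‖ * (wgt i / d i ^ 2) := by ring

/-- One summand `w ↦ c ‖p + w‖⁻¹` is smooth at `w` when `p + w ≠ 0`. [folklore] -/
theorem bc_contDiffAt_summand {p w : E3} (h : p + w ≠ 0) (c : ℝ) {n : WithTop ℕ∞} :
    ContDiffAt ℝ n (fun w : E3 ↦ c * ‖p + w‖⁻¹) w :=
  contDiffAt_const.mul (((contDiffAt_const.add contDiffAt_id).norm ℝ h).inv (norm_ne_zero_iff.2 h))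

/-- The iterated derivative of one summand: `Dᵐ(w ↦ c ‖p + w‖⁻¹)(w) = c • Dᵐ(‖·‖⁻¹)(p + w)` (linearity and
translation invariance of `iteratedFDeriv`). [folklore] -/
theorem bc_iteratedFDeriv_summand {p w : E3} (h : p + w ≠ 0) (c : ℝ) (m : ℕ) :
    iteratedFDeriv ℝ m (fun w : E3 ↦ c * ‖p + w‖⁻¹) w =
      c • iteratedFDeriv ℝ m (fun v : E3 ↦ ‖v‖⁻¹) (p + w) := by
  have h1 : ContDiffAt ℝ m (fun w : E3 ↦ ‖p + w‖⁻¹) w :=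
    ((contDiffAt_const.add contDiffAt_id).norm ℝ h).inv (norm_ne_zero_iff.2 h)
  have h2 : (fun w : E3 ↦ c * ‖p + w‖⁻¹) = c • fun w : E3 ↦ ‖p + w‖⁻¹ := rfl
  rw [h2, iteratedFDeriv_const_smul_apply h1, iteratedFDeriv_comp_add_left (f := fun v : E3 ↦ ‖v‖⁻¹) m p w]

/-- The iterated derivative of the finite Coulomb sum is the weighted sum of translated derivatives of the
Newton kernel. [folklore] -/
theorem bc_iteratedFDeriv_sum (S : Finset ℕ) (p : ℕ → E3) (wgt : ℕ → ℝ) (w : E3)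
    (h : ∀ i ∈ S, p i + w ≠ 0) (m : ℕ) :
    iteratedFDeriv ℝ m (fun w : E3 ↦ ∑ i ∈ S, wgt i * ‖p i + w‖⁻¹) w =
      ∑ i ∈ S, wgt i • iteratedFDeriv ℝ m (fun v : E3 ↦ ‖v‖⁻¹) (p i + w) := by
  rw [iteratedFDeriv_fun_sum_apply fun i hi ↦ bc_contDiffAt_summand (h i hi) (wgt i)]
  exact Finset.sum_congr rfl fun i hi ↦ bc_iteratedFDeriv_summand (h i hi) (wgt i) m

/-- The finite Coulomb sum is smooth at `w` when every `pᵢ + w ≠ 0`. [folklore] -/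
theorem bc_contDiffAt_sum (S : Finset ℕ) (p : ℕ → E3) (wgt : ℕ → ℝ) (w : E3)
    (h : ∀ i ∈ S, p i + w ≠ 0) {n : WithTop ℕ∞} :
    ContDiffAt ℝ n (fun w : E3 ↦ ∑ i ∈ S, wgt i * ‖p i + w‖⁻¹) w :=
  ContDiffAt.sum fun i hi ↦ bc_contDiffAt_summand (h i hi) (wgt i)

/-- **The derivative bound**: given the Newton-kernel bounds `‖Dᵐ(‖·‖⁻¹)(u)‖ ≤ C₁/‖u‖^{m+1}` (`m ≤ 3`),
`‖DᵐG(w)‖ ≤ 8 C₁ Σ wgtᵢ/dᵢ^{m+1}` for `m ≤ 2` (each source sits at distance `≥ dᵢ/2` from `-w`). [folklore] -/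
theorem bc_norm_iteratedFDeriv_sum_le {C₁ : ℝ} (hC₁ : 0 ≤ C₁)
    (hN : ∀ u : E3, u ≠ 0 → ∀ m : ℕ, m ≤ 3 →
      ‖iteratedFDeriv ℝ m (fun v : E3 ↦ ‖v‖⁻¹) u‖ ≤ C₁ / ‖u‖ ^ (m + 1))
    (S : Finset ℕ) (p : ℕ → E3) (wgt d : ℕ → ℝ)
    (hwgt : ∀ i ∈ S, 0 ≤ wgt i) (hd : ∀ i ∈ S, 0 < d i ∧ d i ≤ ‖p i‖)
    (w : E3) (hw : ∀ i ∈ S, ‖w‖ ≤ d i / 2) {m : ℕ} (hm : m ≤ 2) :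
    ‖iteratedFDeriv ℝ m (fun w : E3 ↦ ∑ i ∈ S, wgt i * ‖p i + w‖⁻¹) w‖ ≤
      8 * C₁ * ∑ i ∈ S, wgt i / d i ^ (m + 1) := by
  have hpos : ∀ i ∈ S, d i / 2 ≤ ‖p i + w‖ := fun i hi ↦ bc_half_le_norm_add (hd i hi).2 (hw i hi)
  have hne : ∀ i ∈ S, p i + w ≠ 0 := fun i hi ↦ bc_add_ne_zero (hd i hi).1 (hd i hi).2 (hw i hi)
  rw [bc_iteratedFDeriv_sum S p wgt w hne m, Finset.mul_sum]
  refine (norm_sum_le _ _).trans (Finset.sum_le_sum fun i hi ↦ ?_)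
  have hdi : 0 < d i := (hd i hi).1
  have h2 : (2 : ℝ) ^ (m + 1) ≤ 8 :=
    calc (2 : ℝ) ^ (m + 1) ≤ 2 ^ 3 := pow_le_pow_right₀ (by norm_num) (by omega)
      _ = 8 := by norm_num
  rw [norm_smul, Real.norm_of_nonneg (hwgt i hi)]
  calc wgt i * ‖iteratedFDeriv ℝ m (fun v : E3 ↦ ‖v‖⁻¹) (p i + w)‖
      ≤ wgt i * (C₁ / (d i / 2) ^ (m + 1)) := by
        refine mul_le_mul_of_nonneg_left ((hN _ (hne i hi) m (by omega)).trans ?_) (hwgt i hi)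
        exact div_le_div_of_nonneg_left hC₁ (by positivity) (pow_le_pow_left₀ (by positivity) (hpos i hi) _)
    _ = wgt i / d i ^ (m + 1) * (2 ^ (m + 1) * C₁) := by
        rw [div_pow, div_div_eq_mul_div]
        ring
    _ ≤ wgt i / d i ^ (m + 1) * (8 * C₁) :=
        mul_le_mul_of_nonneg_left (mul_le_mul_of_nonneg_right h2 hC₁)
          (div_nonneg (hwgt i hi) (pow_nonneg hdi.le _))
    _ = 8 * C₁ * (wgt i / d i ^ (m + 1)) := by ring

/-! ## §3 The registered stub -/

/-- **STUB BK3b `stub_bulkCoulomb`** (the Newton kernel and the evaluation-shift Taylor bound): (i)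
`‖Dᵐ(‖·‖⁻¹)(u)‖ ≤ C/‖u‖ᵐ⁺¹` for `m ≤ 3` (homogeneity of degree `−1` and compactness of the unit sphere); (ii) for
finitely many sources `p_i` at distance `≥ d_i` with weights `wgt_i ≥ 0`, the potential `G(w) = Σ wgt_i/‖p_i + w‖` on
`‖w‖ ≤ d_i/2` satisfies `|G(w) − G(0)| ≤ C‖w‖ Σ wgt_i/d_i²` and `‖DᵐG(w)‖ ≤ C Σ wgt_i/d_iᵐ⁺¹` (`m = 1, 2`), and is
smooth there. [folklore] -/
theorem stub_bulkCoulomb :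
    (∃ C : ℝ, 0 < C ∧ ∀ u : E3, u ≠ 0 → ∀ m : ℕ, m ≤ 3 →
      ‖iteratedFDeriv ℝ m (fun v : E3 ↦ ‖v‖⁻¹) u‖ ≤ C / ‖u‖ ^ (m + 1)) ∧
    (∃ C : ℝ, 0 < C ∧ ∀ (S : Finset ℕ) (p : ℕ → E3) (wgt d : ℕ → ℝ),
      (∀ i ∈ S, 0 ≤ wgt i) → (∀ i ∈ S, 0 < d i ∧ d i ≤ ‖p i‖) →
      ∀ w : E3, (∀ i ∈ S, ‖w‖ ≤ d i / 2) →
        |∑ i ∈ S, wgt i * ‖p i + w‖⁻¹ - ∑ i ∈ S, wgt i * ‖p i‖⁻¹| ≤ C * ‖w‖ * ∑ i ∈ S, wgt i / d i ^ 2 ∧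
        (∀ m : ℕ, 1 ≤ m → m ≤ 2 →
          ‖iteratedFDeriv ℝ m (fun w : E3 ↦ ∑ i ∈ S, wgt i * ‖p i + w‖⁻¹) w‖ ≤ C * ∑ i ∈ S, wgt i / d i ^ (m + 1)) ∧
        ContDiffAt ℝ ∞ (fun w : E3 ↦ ∑ i ∈ S, wgt i * ‖p i + w‖⁻¹) w) := by
  obtain ⟨C₁, hC₁, hN⟩ := bc_newton_bounds
  refine ⟨⟨C₁, hC₁, hN⟩, 2 + 8 * C₁, by positivity, fun S p wgt d hwgt hd w hw ↦ ⟨?_, ?_, ?_⟩⟩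
  · have hsum : 0 ≤ ∑ i ∈ S, wgt i / d i ^ 2 :=
      Finset.sum_nonneg fun i hi ↦ div_nonneg (hwgt i hi) (pow_nonneg (hd i hi).1.le _)
    calc |∑ i ∈ S, wgt i * ‖p i + w‖⁻¹ - ∑ i ∈ S, wgt i * ‖p i‖⁻¹|
        ≤ 2 * ‖w‖ * ∑ i ∈ S, wgt i / d i ^ 2 := bc_sum_shift_le S p wgt d hwgt hd w hw
      _ ≤ (2 + 8 * C₁) * ‖w‖ * ∑ i ∈ S, wgt i / d i ^ 2 :=
        mul_le_mul_of_nonneg_right (mul_le_mul_of_nonneg_right (by linarith) (norm_nonneg w)) hsum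
  · intro m _ hm
    have hsum : 0 ≤ ∑ i ∈ S, wgt i / d i ^ (m + 1) :=
      Finset.sum_nonneg fun i hi ↦ div_nonneg (hwgt i hi) (pow_nonneg (hd i hi).1.le _)
    calc ‖iteratedFDeriv ℝ m (fun w : E3 ↦ ∑ i ∈ S, wgt i * ‖p i + w‖⁻¹) w‖
        ≤ 8 * C₁ * ∑ i ∈ S, wgt i / d i ^ (m + 1) :=
          bc_norm_iteratedFDeriv_sum_le hC₁.le hN S p wgt d hwgt hd w hw hm
      _ ≤ (2 + 8 * C₁) * ∑ i ∈ S, wgt i / d i ^ (m + 1) :=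
          mul_le_mul_of_nonneg_right (by linarith) hsum
  · exact bc_contDiffAt_sum S p wgt w fun i hi ↦ bc_add_ne_zero (hd i hi).1 (hd i hi).2 (hw i hi)

end Summit.FinalStateConjecture.FinalStateConjecture.Theorems.SwallowTheDatum.ParametricKerrBurial
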